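import Mathlib.NumberTheory.NumberField.Units.DirichletTheorem
import HarnessLib

/-!
# Serre's congruence subgroup property for `SL₂(𝓞_F)` — proofs, V: integers with prescribed signs

Topic `Literature/NumberTheory/Automorphic`; namespace `Literature.NumberTheory.Automorphic`
(sub-namespace `SerreSL2`).  Everything here is PROVED; no definitions, no named facts.  (The
infinite place of a real embedding `φ : K →+* ℝ` is written `InfinitePlace.mk ((algebraMap ℝ ℂ).comp φ)`.)

The "Dirichlet theorem" of Bass–Milnor–Serre ((A.10): primes `𝔭 = (b₁)` with `b₁` in a prescribed
class modulo `𝔞` *and of prescribed signs at the real places*) is used in the proof of BMS Thm. 3.5,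
Case 1 ("`b₁` is close to `v` at `𝔭_∞`, `b₁` is close to `1` at all `𝔭 ∈ S_∞ - {𝔭_∞}`").  The tree's
Landau theorem on primes in narrow ray classes produces generators whose signs agree with those of a
given representative (`SerreSL2.exists_prime_mul_eq_span_singleton`,
`CongruenceSubgroupPropertySL2Dirichlet.lean`); this file supplies the representative:

* `SerreSL2.exists_lt_and_forall_abs_lt_one` — for a real embedding `φ` and a bound `D` there is
  `y ∈ 𝓞 K` with `φ(y) > max(D, 0)` and `|ψ(y)| < 1` at every other real embedding (an even power of
  the unit attached to the place of `φ` by Mathlib's proof of Dirichlet's unit theorem,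
  `NumberField.Units.dirichletUnitTheorem.exists_unit`, which is `> 1` at `φ` by
  `∑_w mult(w) log |u|_w = 0`);
* `SerreSL2.exists_sub_mem_and_sign` — **in every congruence class modulo an ideal `𝔪 ≠ 0` of `𝓞 K`
  there are elements with arbitrarily prescribed signs at the real embeddings**
  (`x = x₁ + N𝔪 · ∑_φ ± y_φ`).

## References

* [BassMilnorSerre1967] H. Bass, J. Milnor, J.-P. Serre, *Solution of the congruence subgroup
  problem for `SL_n` (`n ≥ 3`) and `Sp_{2n}` (`n ≥ 2`)*, Publ. Math. IHES 33 (1967), Appendix (A.10)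
  and Ch. I Thm. 3.5 (Case 1).
-/

open NumberField InfinitePlace

namespace Literature.NumberTheory.Automorphic

namespace SerreSL2

variable {K : Type*} [Field K]

/-- `|x|_{w_φ} = |φ x|` for the place `w_φ` of a real embedding `φ`. [folklore] -/
theorem mk_comp_algebraMap_apply (φ : K →+* ℝ) (x : K) :
    InfinitePlace.mk ((algebraMap ℝ ℂ).comp φ) x = |φ x| := by
  rw [InfinitePlace.apply, RingHom.comp_apply, Complex.coe_algebraMap, Complex.norm_real,
    Real.norm_eq_abs]

/-- Distinct real embeddings define distinct places. [folklore] -/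
theorem mk_comp_algebraMap_injective :
    Function.Injective fun φ : K →+* ℝ ↦ InfinitePlace.mk ((algebraMap ℝ ℂ).comp φ) := by
  intro φ ψ h
  have hconj : ComplexEmbedding.conjugate ((algebraMap ℝ ℂ).comp φ) = (algebraMap ℝ ℂ).comp φ := by
    ext1 x
    rw [ComplexEmbedding.conjugate_coe_eq, RingHom.comp_apply, Complex.coe_algebraMap,
      Complex.conj_ofReal]
  simp only [InfinitePlace.mk_eq_iff] at h
  have h' : (algebraMap ℝ ℂ).comp φ = (algebraMap ℝ ℂ).comp ψ := by
    rcases h with h | h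
    · exact h
    · rwa [hconj] at h
  ext1 x
  have := RingHom.congr_fun h' x
  simpa using this

variable [NumberField K]

/-- For each real embedding `φ` and each bound `D` there is `y ∈ 𝓞 K` with `φ(y) > max(D, 0)` and
`|ψ(y)| < 1` at every other real embedding `ψ` (a power of a suitable unit from Dirichlet's unit
theorem, Mathlib `NumberField.Units.dirichletUnitTheorem.exists_unit`). [folklore] -/
theorem exists_lt_and_forall_abs_lt_one (φ : K →+* ℝ) (D : ℝ) :
    ∃ y : 𝓞 K, D < φ y ∧ 0 < φ y ∧ ∀ ψ : K →+* ℝ, ψ ≠ φ → |ψ y| < 1 := by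
  classical
  by_cases hψ : ∃ ψ : K →+* ℝ, ψ ≠ φ
  · obtain ⟨u, hu⟩ :=
      NumberField.Units.dirichletUnitTheorem.exists_unit K (InfinitePlace.mk ((algebraMap ℝ ℂ).comp φ))
    have hupos : ∀ w : InfinitePlace K, 0 < w (((u : 𝓞 K) : K)) := fun w ↦
      NumberField.Units.pos_at_place u w
    -- `|ψ u| < 1` for `ψ ≠ φ`
    have hlt : ∀ ψ : K →+* ℝ, ψ ≠ φ → |ψ ((u : 𝓞 K) : K)| < 1 := fun ψ hne ↦ by
      have h := hu (InfinitePlace.mk ((algebraMap ℝ ℂ).comp ψ))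
        (fun heq ↦ hne (mk_comp_algebraMap_injective heq))
      rw [Real.log_neg_iff (hupos _)] at h
      rwa [mk_comp_algebraMap_apply] at h
    -- `1 < |φ u|` from `∑_w mult(w) log |u|_w = 0`
    have hgt : 1 < |φ ((u : 𝓞 K) : K)| := by
      obtain ⟨ψ₀, hψ₀⟩ := hψ
      have hsum := NumberField.Units.sum_mult_mul_log u
      set wφ := InfinitePlace.mk ((algebraMap ℝ ℂ).comp φ) with hwφ
      rw [← Finset.add_sum_erase _ _ (Finset.mem_univ wφ)] at hsum
      have hneg : ∑ w ∈ Finset.univ.erase wφ, (w.mult : ℝ) * Real.log (w (((u : 𝓞 K) : K))) < 0 := by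
        apply Finset.sum_neg
        · intro w hw
          exact mul_neg_of_pos_of_neg (Nat.cast_pos.2 InfinitePlace.mult_pos)
            (hu w (Finset.ne_of_mem_erase hw))
        · exact ⟨InfinitePlace.mk ((algebraMap ℝ ℂ).comp ψ₀), Finset.mem_erase.2
            ⟨fun h ↦ hψ₀ (mk_comp_algebraMap_injective h), Finset.mem_univ _⟩⟩
      have hpos : 0 < (wφ.mult : ℝ) * Real.log (wφ (((u : 𝓞 K) : K))) := by linarith
      have hlog : 0 < Real.log (wφ (((u : 𝓞 K) : K))) :=
        pos_of_mul_pos_right hpos (Nat.cast_nonneg _)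
      rw [Real.log_pos_iff (hupos _).le, hwφ, mk_comp_algebraMap_apply] at hlog
      exact hlog
    have hsq : 1 < (φ ((u : 𝓞 K) : K)) ^ 2 := by
      rw [← sq_abs]
      exact one_lt_pow₀ hgt two_ne_zero
    obtain ⟨k, hk⟩ := pow_unbounded_of_one_lt D hsq
    refine ⟨((u ^ (2 * (k + 1)) : (𝓞 K)ˣ) : 𝓞 K), ?_, ?_, fun ψ hne ↦ ?_⟩
    · have : φ ((((u ^ (2 * (k + 1)) : (𝓞 K)ˣ) : 𝓞 K) : K)) = ((φ ((u : 𝓞 K) : K)) ^ 2) ^ (k + 1) := by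
        rw [Units.val_pow_eq_pow_val, RingOfIntegers.coe_eq_algebraMap, map_pow, map_pow, pow_mul]
      rw [this, pow_succ]
      exact lt_of_lt_of_le hk (le_mul_of_one_le_right (pow_nonneg (sq_nonneg _) _) hsq.le)
    · rw [Units.val_pow_eq_pow_val, RingOfIntegers.coe_eq_algebraMap, map_pow, map_pow, pow_mul]
      exact pow_pos (lt_trans one_pos hsq) _
    · rw [Units.val_pow_eq_pow_val, RingOfIntegers.coe_eq_algebraMap, map_pow, map_pow, abs_pow]
      exact pow_lt_one₀ (abs_nonneg _) (hlt ψ hne) (by omega)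
  · -- `φ` is the only real embedding
    simp only [not_exists, not_not] at hψ
    obtain ⟨n, hn⟩ := exists_nat_gt (max D 0)
    refine ⟨n, ?_, ?_, fun ψ hne ↦ (hne (hψ ψ)).elim⟩
    · have : φ ((n : 𝓞 K) : K) = n := by simp
      rw [this]; exact lt_of_le_of_lt (le_max_left _ _) hn
    · have : φ ((n : 𝓞 K) : K) = n := by simp
      rw [this]; exact lt_of_le_of_lt (le_max_right _ _) hn

/-- **Elements of a congruence class with prescribed signs at the real embeddings**: for an ideal
`𝔪 ≠ 0` of `𝓞 K`, any `x₁ ∈ 𝓞 K` and any set `P` of real embeddings there is `x ≡ x₁ (mod 𝔪)` with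
`φ(x) < 0` for `φ ∈ P` and `φ(x) > 0` for `φ ∉ P` (`x = x₁ + N𝔪 · z` with `z = ∑_φ ± y_φ`,
`y_φ` large at `φ` and small elsewhere). [folklore] -/
theorem exists_sub_mem_and_sign {𝔪 : Ideal (𝓞 K)} (h𝔪 : 𝔪 ≠ ⊥) (x₁ : 𝓞 K)
    (P : (K →+* ℝ) → Prop) :
    ∃ x : 𝓞 K, x - x₁ ∈ 𝔪 ∧ ∀ φ : K →+* ℝ, (P φ → φ x < 0) ∧ (¬ P φ → 0 < φ x) := by
  classical
  set M : ℕ := Ideal.absNorm 𝔪 with hM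
  have hMmem : ((M : ℕ) : 𝓞 K) ∈ 𝔪 := Ideal.absNorm_mem 𝔪
  have hM0 : (0 : ℝ) < M := by
    have : M ≠ 0 := by rw [hM, Ne, Ideal.absNorm_eq_zero_iff]; exact h𝔪
    positivity
  set r : ℕ := Fintype.card (K →+* ℝ) with hr
  have hy := fun φ : K →+* ℝ ↦ exists_lt_and_forall_abs_lt_one φ (r + |φ x₁| / M)
  choose y hyD hy0 hy1 using hy
  set s : (K →+* ℝ) → ℤ := fun φ ↦ if P φ then -1 else 1 with hs
  have hsabs : ∀ φ, |(s φ : ℝ)| = 1 := fun φ ↦ by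
    simp only [hs]; split_ifs <;> simp
  set z : 𝓞 K := ∑ ψ, (s ψ : 𝓞 K) * y ψ with hz
  refine ⟨x₁ + M * z, by simpa using 𝔪.mul_mem_right z hMmem, fun φ ↦ ?_⟩
  have hφz : φ (z : K) = ∑ ψ, (s ψ : ℝ) * φ (y ψ) := by
    simp only [hz]
    push_cast
    rw [map_sum]
    simp only [map_mul, map_intCast]
  have hφx : φ (((x₁ + M * z : 𝓞 K)) : K) = φ x₁ + M * φ (z : K) := by
    push_cast
    rw [map_add, map_mul, map_natCast]
  -- the other terms are small
  set rest := ∑ ψ ∈ Finset.univ.erase φ, (s ψ : ℝ) * φ (y ψ) with hrest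
  have hsplit : φ (z : K) = s φ * φ (y φ) + rest := by
    rw [hφz, ← Finset.add_sum_erase _ _ (Finset.mem_univ φ)]
  have hrest_le : |rest| ≤ r := by
    calc |rest| ≤ ∑ ψ ∈ Finset.univ.erase φ, |(s ψ : ℝ) * φ (y ψ)| := Finset.abs_sum_le_sum_abs _ _
      _ ≤ ∑ ψ ∈ Finset.univ.erase φ, (1 : ℝ) := by
          refine Finset.sum_le_sum fun ψ hψ ↦ ?_
          rw [abs_mul, hsabs, one_mul]
          exact (hy1 ψ φ (Finset.ne_of_mem_erase hψ).symm).le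
      _ ≤ r := by
          rw [Finset.sum_const, nsmul_eq_mul, mul_one, hr]
          exact_mod_cast Finset.card_erase_le
  have hrest1 := (abs_le.1 hrest_le).1
  have hrest2 := (abs_le.1 hrest_le).2
  have hyφ := hyD φ
  have hkey : (M : ℝ) * r + |φ x₁| < M * φ (y φ) := by
    have := mul_lt_mul_of_pos_left hyφ hM0
    rwa [mul_add, mul_div_cancel₀ _ hM0.ne'] at this
  have hMr1 : (M : ℝ) * rest ≤ M * r := mul_le_mul_of_nonneg_left hrest2 hM0.le
  have hMr2 : -((M : ℝ) * r) ≤ M * rest := by nlinarith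
  have habs1 := le_abs_self (φ x₁)
  have habs2 := neg_abs_le (φ x₁)
  rw [hφx, hsplit]
  constructor
  · intro hP
    have hsφ : (s φ : ℝ) = -1 := by simp [hs, hP]
    rw [hsφ]
    nlinarith
  · intro hP
    have hsφ : (s φ : ℝ) = 1 := by simp [hs, hP]
    rw [hsφ]
    nlinarith

end SerreSL2

end Literature.NumberTheory.Automorphic
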